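import Mathlib
import HarnessLib
import Summits.CriticalPhenomena.CardyFormulaZ2.Theses.CardySelfRefinement
import Literature.Probability.RandomPlanarGeometry.ChordalReversibility
import Literature.Probability.RandomPlanarGeometry.ConformalRectangle
import Literature.Probability.RandomPlanarGeometry.IsometryCovariance
import Literature.Probability.Percolation.IkhlefPonsaingFirstPassage
import Summits.CriticalPhenomena.CardyFormulaZ2.Theorems.CardySelfRefinementSymmetryUpgradeRTouchAssembly
import Summits.CriticalPhenomena.CardyFormulaZ2.Theorems.CardySelfRefinementSymmetryUpgradeRTouchSepDictionary
import Summits.CriticalPhenomena.CardyFormulaZ2.Theorems.CardySelfRefinementSymmetryUpgradeRTouchWiredArmLower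

/-!
# S3 `stub_touchExponent` of line `SketchIdeatorTwo` (crux `SymmetryUpgradeR`, stmt-CriticalPhenomena-17239)
# CONDITIONAL on Ikhlef–Ponsaing's first-passage identity — assembly

The registered stub `stub_touchExponent` (revision 2, flat-wall ∃-form): for the pinned family `P` of clause (iv)
there is a Dobrushin domain with a locally flat boundary point `z` on its dual-wired arc at which
`c ε^{1/3} ≤ P D {γ comes ε-close to z} ≤ C ε^{1/3}`. This file proves it CONDITIONALLY on the tree's named fact
`Literature.Probability.Percolation.IkhlefPonsaingFirstPassage` (Ikhlef–Ponsaing, J. Stat. Phys. 149 (2012) Prop. 4.7;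
refereed, vendored unproved, being formalised for crux `HalfPlaneOneArmThird`), assembling the landed pieces of waves
1–3 of this line (all `Theorems/CardySelfRefinementSymmetryUpgradeRTouch*.lean`):

* `touchExponent_of_lowerLatticeBound` (…TouchAssembly, p137778): the fact + a LOWER lattice touch bound in the
  triangle `(Δ; −1, −i)`, `Δ = {re < 0, im < 0, re + im > −1}` (wired legs, free diagonal hypotenuse, flat wall at
  `z = −(1+i)/2`) ⇒ the stub verbatim (upper bound: …TouchUpperLattice p137540 via the two-scale diagonal arm
  …TouchTwoScaleArm p136530, from the two-sided IP asymptotics …TouchRecursionTwoSided p135761 /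
  …TouchDiagArmTwoSided p135949; domain …TouchTriangleDomain p136663; limit passage by portmanteau
  …TouchExponentOfLatticeBounds p134318);
* `touchExponent_lowerLatticeBound_of` (…TouchAssembly): the lower bound ⇐ (L1) separation dictionary + (L2) wired arm;
* (L1) `touchExponent_sepDictionary` (…TouchSepDictionary p140400, with …TouchSepCycle/Triangle/Core): a wired-cluster
  path to a site `v` forces the exploration polygon within `dist(δv, δw) + 4δ` of `δv` for every free-arc site `w`;
* (L2) `touchExponent_wiredArmLower` (…TouchWiredArmLower p140501, with …TouchWiredArmGlue/Region): conditionally on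
  the fact, with probability `≥ c ε^{1/3}` eventually in `δ`, a wired arm reaches `ε/4`-close to `z` next to a
  free-arc site.

So the exact boundary-touch exponent `1/3` of the ℤ² interface limit family is reduced to ONE printed theorem.
-/

noncomputable section

namespace Summit.CriticalPhenomena.CardyFormulaZ2.Theorems.SymmetryUpgradeR.SwallowingSkeleton

open MeasureTheory Filter Set
open Literature.Probability.RandomPlanarGeometry Literature.Probability.LatticeModels
  Literature.Probability.Percolation
open UpperHalfPlane (upperHalfPlaneSet)

/-- **S3 conditional on Ikhlef–Ponsaing.** `IkhlefPonsaingFirstPassage →` the registered statement of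
`stub_touchExponent` verbatim: the clause-(iv) family has boundary-touch exponent exactly `1/3` (two-sided
constants) at the flat diagonal wall point `z = −(1+i)/2` of the triangle `(Δ; −1, −i)`. Assembly of
`touchExponent_of_lowerLatticeBound`, `touchExponent_lowerLatticeBound_of`, `touchExponent_sepDictionary` (L1) and
`touchExponent_wiredArmLower` (L2). -/
theorem touchExponent_of_ikhlefPonsaing : Literature.Probability.Percolation.IkhlefPonsaingFirstPassage → ∀ P : ChordalFamily, IsLocalMarkovChordalFamily P → (∀ D : DobrushinDomain, ∀ᵐ γ ∂(P D), ∀ c : Curve ℂ, CurveClass.mk c = γ → ∀ s t : unitInterval, s < t → c '' Set.Icc s t ⊆ frontier D.carrier → (c '' Set.Icc s t).Subsingleton) → ((∀ (D : DobrushinDomain) (E : ℝ → DiscreteDobrushin), ZdDiscretisationFamily D E → ∀ᶠ δ in nhdsWithin (0 : ℝ) (Set.Ioi 0), AEMeasurable (bondInterfaceIn D (E δ)) (bondPercolation (zdGraph 2) half)) ∧ ∃ δs : ℕ → ℝ, (∀ n, 0 < δs n) ∧ Tendsto δs atTop (nhds 0) ∧ ∀ (D : DobrushinDomain) (E : ℝ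 → DiscreteDobrushin), ZdDiscretisationFamily D E → ∀ f : BoundedContinuousFunction (CurveClass ℂ) ℝ, Tendsto (fun n => ∫ ω, f (bondInterfaceIn D (E (δs n)) ω) ∂(bondPercolation (zdGraph 2) half)) atTop (nhds (∫ γ, f γ ∂(P D)))) → (∃ (D : DobrushinDomain) (z u : ℂ) (r : ℝ), z ∈ D.arc 1 ∧ z ≠ D.pt 0 ∧ z ≠ D.pt 1 ∧ ‖u‖ = 1 ∧ 0 < r ∧ D.carrier ∩ Metric.ball z r = {w | w ∈ Metric.ball z r ∧ 0 < ((starRingEnd ℂ) u * (w - z)).im} ∧ ∃ c C ε₀ : ℝ, 0 < c ∧ 0 < ε₀ ∧ ∀ ε ∈ Set.Ioo 0 ε₀, c * ε ^ (1 / 3 : ℝ) ≤ (P D).real {γ | ∃ w ∈ γ.range, dist w z < ε} ∧ (P D).real {γ | ∃ w ∈ γ.range, dist w z < ε} ≤ C * ε ^ (1 / 3 : ℝ)) := by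
  intro hIP
  refine touchExponent_of_lowerLatticeBound hIP fun D E hcar hp0 hp1 hA0 hA1 hE => ?_
  obtain ⟨c, ε₀, hc, hε₀, h⟩ := touchExponent_wiredArmLower hIP D E hcar hp0 hp1 hA0 hA1 hE
  exact ⟨c, ε₀, hc, hε₀, touchExponent_lowerLatticeBound_of D E _ c ε₀ hE hε₀
    (touchExponent_sepDictionary D E hcar hp0 hp1 hA0 hA1 hE) h⟩

end Summit.CriticalPhenomena.CardyFormulaZ2.Theorems.SymmetryUpgradeR.SwallowingSkeleton

end
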